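import Summits.NavierStokesRegularity.NavierStokesRegularity.Theorems.FilamentSkeletonRssDefectColumnGateVorticityAdjoint
import Literature.Analysis.FluidPDE.WholeSpaceIBP

/-!
# Route `FilamentSkeletonRss` · ∀-crux `TransverseReduction1AR` (stmt-NavierStokesRegularity-23611) — NEGATIVE-side groundwork:
# the INTEGRATED adjoint identity `∫⟪Ψ, 𝒯_U Ω⟫ = ∫⟪𝒯_U^*Ψ, Ω⟫` for compactly supported test fields

Helper file (theorems only), `--supports stmt-NavierStokesRegularity-23611 --as helper`; LEAD of 23611 / registrar of 23920, lane ns-filament-21221-p1 g14.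

Integrating `vorticity_lagrange_identity` (p693934) over `ℝ³` against a COMPACTLY SUPPORTED test field `Ψ` kills the divergence (`integral_divergence_eq_zero`, Leray 1934 §6):
`∫ ⟪Ψ, 𝒯_U Ω⟫ = ∫ ⟪𝒯_U^*Ψ, Ω⟫`.  This is the weak/distributional form in which B2′ («NoExactProfileNearGappedSkeleton» / B2′-sym) uses the identity: with `Ψ = χ_R·Ψ*`
(`Ψ*` an adjoint solution, `χ_R` a basin cut-off) the right side is supported on the cut-off's transition layer and IS the «leak − feed» flux; for an exact profile
(`𝒯_U Ω = 0`, `curl_lerayOp_of_isDivFree`) the left side vanishes.  The sign/size of that flux (LD-a) is not here.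
HONEST FRAMING: calculus bookkeeping on the NEGATIVE side of a HYPOTHETICAL filament-type rotating-self-similar blow-up route (MODEL rung); no item is proved or refuted;
23611/23920 OPEN; nothing here bears on Navier–Stokes regularity, which is NOT proved.
-/

set_option linter.dupNamespace false

noncomputable section

namespace Summit.NavierStokesRegularity.NavierStokesRegularity.Theorems.DefectColumnGate

open scoped BigOperators Topology InnerProductSpace Laplacian ContDiff
open Set Function MeasureTheory
open Literature.Analysis.FluidPDE
open Summit.NavierStokesRegularity.NavierStokesRegularity.Theorems.KelvinGate

/-- The Laplacian of a `C²` field on `ℝ³` is continuous (trace of the continuous second derivative in the standard basis). -/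
theorem continuous_laplacian_of_contDiff_two {F : Type*} [NormedAddCommGroup F] [NormedSpace ℝ F] {f : EuclideanSpace ℝ (Fin 3) → F}
    (hf : ContDiff ℝ 2 f) : Continuous (Δ f) := by
  rw [laplacian_eq_sum_fderiv_fderiv f]
  have h2 : Continuous (fderiv ℝ (fderiv ℝ f)) := (hf.fderiv_right (m := 1) (by norm_num)).continuous_fderiv (by norm_num)
  exact continuous_finsetSum _ fun i _ => (h2.clm_apply continuous_const).clm_apply continuous_const

/-- **INTEGRATED ADJOINT IDENTITY.**  For `U ∈ C²` solenoidal, `Ω ∈ C²`, and a COMPACTLY SUPPORTED test field `Ψ ∈ C²`: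
`∫ ⟪Ψ, α(e₃×Ω − DΩ[e₃×y]) + Ω + ½DΩ[y] − ΔΩ + DΩ[U] − DU[Ω]⟫ = ∫ ⟪−α(e₃×Ψ − DΨ[e₃×y]) − ½Ψ − ½DΨ[y] − ΔΨ − DΨ[U] − (DU)†Ψ, Ω⟫`. -/
theorem integral_vorticity_adjoint (α : ℝ) {U Ω Ψ : EuclideanSpace ℝ (Fin 3) → EuclideanSpace ℝ (Fin 3)}
    (hU : ContDiff ℝ 2 U) (hΩ : ContDiff ℝ 2 Ω) (hΨ : ContDiff ℝ 2 Ψ) (hΨc : HasCompactSupport Ψ) (hdiv : VectorCalculus.IsDivFree U) :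
    ∫ y, ⟪Ψ y, α • (cross (EuclideanSpace.single 2 1) (Ω y) - fderiv ℝ Ω y (cross (EuclideanSpace.single 2 1) y)) + Ω y + (1/2:ℝ) • fderiv ℝ Ω y y
        - (Δ Ω) y + fderiv ℝ Ω y (U y) - fderiv ℝ U y (Ω y)⟫_ℝ
      = ∫ y, ⟪-(α • (cross (EuclideanSpace.single 2 1) (Ψ y) - fderiv ℝ Ψ y (cross (EuclideanSpace.single 2 1) y))) - (1/2:ℝ) • Ψ y - (1/2:ℝ) • fderiv ℝ Ψ y y
        - (Δ Ψ) y - fderiv ℝ Ψ y (U y) - ContinuousLinearMap.adjoint (fderiv ℝ U y) (Ψ y), Ω y⟫_ℝ := by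
  -- the current `J` of the pointwise identity
  set J : EuclideanSpace ℝ (Fin 3) → EuclideanSpace ℝ (Fin 3) := fun z => ⟪Ψ z, Ω z⟫_ℝ • (U z + (1/2:ℝ) • z - α • cross (EuclideanSpace.single 2 1) z)
        + ∑ i : Fin 3, (⟪fderiv ℝ Ψ z (EuclideanSpace.basisFun (Fin 3) ℝ i), Ω z⟫_ℝ - ⟪Ψ z, fderiv ℝ Ω z (EuclideanSpace.basisFun (Fin 3) ℝ i)⟫_ℝ)
          • EuclideanSpace.basisFun (Fin 3) ℝ i with hJ
  have hΨ1 : ContDiff ℝ 1 Ψ := hΨ.of_le (by norm_num)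
  have hΩ1 : ContDiff ℝ 1 Ω := hΩ.of_le (by norm_num)
  have hU1 : ContDiff ℝ 1 U := hU.of_le (by norm_num)
  have hDΨ : ContDiff ℝ 1 (fderiv ℝ Ψ) := hΨ.fderiv_right (m := 1) (by norm_num)
  have hDΩ : ContDiff ℝ 1 (fderiv ℝ Ω) := hΩ.fderiv_right (m := 1) (by norm_num)
  have hrot : ContDiff ℝ 1 (fun z : EuclideanSpace ℝ (Fin 3) => cross (EuclideanSpace.single 2 1) z) := by
    simp only [cross_single_two_eq_rotGenL]; exact rotGenL.contDiff
  -- `J ∈ C¹`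
  have hJ1 : ContDiff ℝ 1 J := by
    refine ((hΨ1.inner ℝ hΩ1).smul ((hU1.add (contDiff_id.const_smul (1/2:ℝ))).sub (hrot.const_smul α))).add ?_
    refine ContDiff.sum fun i _ => ?_
    exact (((hDΨ.clm_apply contDiff_const).inner ℝ hΩ1).sub (hΨ1.inner ℝ (hDΩ.clm_apply contDiff_const))).smul contDiff_const
  -- `J` is supported in `tsupport Ψ`
  have hJc : HasCompactSupport J := by
    refine HasCompactSupport.intro hΨc fun z hz => ?_
    have h0 : Ψ z = 0 := image_eq_zero_of_notMem_tsupport hz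
    have h1 : fderiv ℝ Ψ z = 0 := by
      have : z ∉ tsupport (fderiv ℝ Ψ) := fun h => hz (tsupport_fderiv_subset ℝ h)
      exact image_eq_zero_of_notMem_tsupport this
    simp [hJ, h0, h1]
  -- integrability of both sides (continuous, supported in `tsupport Ψ`)
  have hcΩ : Continuous fun y => α • (cross (EuclideanSpace.single 2 1) (Ω y) - fderiv ℝ Ω y (cross (EuclideanSpace.single 2 1) y)) + Ω y
      + (1/2:ℝ) • fderiv ℝ Ω y y - (Δ Ω) y + fderiv ℝ Ω y (U y) - fderiv ℝ U y (Ω y) := by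
    have hc1 : Continuous fun y => cross (EuclideanSpace.single 2 1) (Ω y) := by
      simp only [cross_single_two_eq_rotGenL]; exact rotGenL.continuous.comp hΩ.continuous
    have hc2 : Continuous fun y => fderiv ℝ Ω y (cross (EuclideanSpace.single 2 1) y) :=
      (hΩ.continuous_fderiv (by norm_num)).clm_apply hrot.continuous
    have hc3 : Continuous fun y => fderiv ℝ Ω y y := (hΩ.continuous_fderiv (by norm_num)).clm_apply continuous_id
    have hc4 : Continuous fun y => fderiv ℝ Ω y (U y) := (hΩ.continuous_fderiv (by norm_num)).clm_apply hU.continuous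
    have hc5 : Continuous fun y => fderiv ℝ U y (Ω y) := (hU.continuous_fderiv (by norm_num)).clm_apply hΩ.continuous
    exact (((((hc1.sub hc2).const_smul α).add hΩ.continuous).add (hc3.const_smul (1/2:ℝ))).sub (continuous_laplacian_of_contDiff_two hΩ)).add hc4 |>.sub hc5
  have hcΨ : Continuous fun y => -(α • (cross (EuclideanSpace.single 2 1) (Ψ y) - fderiv ℝ Ψ y (cross (EuclideanSpace.single 2 1) y))) - (1/2:ℝ) • Ψ y
      - (1/2:ℝ) • fderiv ℝ Ψ y y - (Δ Ψ) y - fderiv ℝ Ψ y (U y) - ContinuousLinearMap.adjoint (fderiv ℝ U y) (Ψ y) := by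
    have hc1 : Continuous fun y => cross (EuclideanSpace.single 2 1) (Ψ y) := by
      simp only [cross_single_two_eq_rotGenL]; exact rotGenL.continuous.comp hΨ.continuous
    have hc2 : Continuous fun y => fderiv ℝ Ψ y (cross (EuclideanSpace.single 2 1) y) :=
      (hΨ.continuous_fderiv (by norm_num)).clm_apply hrot.continuous
    have hc3 : Continuous fun y => fderiv ℝ Ψ y y := (hΨ.continuous_fderiv (by norm_num)).clm_apply continuous_id
    have hc4 : Continuous fun y => fderiv ℝ Ψ y (U y) := (hΨ.continuous_fderiv (by norm_num)).clm_apply hU.continuous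
    have hc5 : Continuous fun y => ContinuousLinearMap.adjoint (fderiv ℝ U y) (Ψ y) :=
      ((ContinuousLinearMap.adjoint : (EuclideanSpace ℝ (Fin 3) →L[ℝ] EuclideanSpace ℝ (Fin 3)) ≃ₗᵢ⋆[ℝ]
        (EuclideanSpace ℝ (Fin 3) →L[ℝ] EuclideanSpace ℝ (Fin 3))).continuous.comp (hU.continuous_fderiv (by norm_num))).clm_apply hΨ.continuous
    exact (((((hc1.sub hc2).const_smul α).neg.sub (hΨ.continuous.const_smul (1/2:ℝ))).sub (hc3.const_smul (1/2:ℝ))).sub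
      (continuous_laplacian_of_contDiff_two hΨ)).sub hc4 |>.sub hc5
  have hsuppL : ∀ y ∉ tsupport Ψ, ⟪Ψ y, α • (cross (EuclideanSpace.single 2 1) (Ω y) - fderiv ℝ Ω y (cross (EuclideanSpace.single 2 1) y)) + Ω y
      + (1/2:ℝ) • fderiv ℝ Ω y y - (Δ Ω) y + fderiv ℝ Ω y (U y) - fderiv ℝ U y (Ω y)⟫_ℝ = 0 := fun y hy => by
    rw [image_eq_zero_of_notMem_tsupport hy, inner_zero_left]
  have hsuppR : ∀ y ∉ tsupport Ψ, ⟪-(α • (cross (EuclideanSpace.single 2 1) (Ψ y) - fderiv ℝ Ψ y (cross (EuclideanSpace.single 2 1) y))) - (1/2:ℝ) • Ψ y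
      - (1/2:ℝ) • fderiv ℝ Ψ y y - (Δ Ψ) y - fderiv ℝ Ψ y (U y) - ContinuousLinearMap.adjoint (fderiv ℝ U y) (Ψ y), Ω y⟫_ℝ = 0 := by
    intro y hy
    have h0 : Ψ y = 0 := image_eq_zero_of_notMem_tsupport hy
    have h1 : fderiv ℝ Ψ y = 0 := by
      have : y ∉ tsupport (fderiv ℝ Ψ) := fun h => hy (tsupport_fderiv_subset ℝ h)
      exact image_eq_zero_of_notMem_tsupport this
    have h2 : (Δ Ψ) y = 0 := by
      -- `Ψ = 0` near `y`, so its Laplacian vanishes at `y`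
      have hev : Ψ =ᶠ[𝓝 y] fun _ => (0 : EuclideanSpace ℝ (Fin 3)) := by
        have : (tsupport Ψ)ᶜ ∈ 𝓝 y := (isClosed_tsupport Ψ).isOpen_compl.mem_nhds hy
        filter_upwards [this] with z hz using image_eq_zero_of_notMem_tsupport hz
      have h := (InnerProductSpace.laplacian_congr_nhds hev).self_of_nhds
      rw [h, InnerProductSpace.laplacian_const]; rfl
    have h3 : rotGen (0 : EuclideanSpace ℝ (Fin 3)) = 0 := map_zero rotGenL
    rw [h0, h1, h2]; simp [cross_single_two_eq_rotGenL, h3]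
  have hiL : Integrable (fun y => ⟪Ψ y, α • (cross (EuclideanSpace.single 2 1) (Ω y) - fderiv ℝ Ω y (cross (EuclideanSpace.single 2 1) y)) + Ω y
      + (1/2:ℝ) • fderiv ℝ Ω y y - (Δ Ω) y + fderiv ℝ Ω y (U y) - fderiv ℝ U y (Ω y)⟫_ℝ) :=
    (hΨ.continuous.inner hcΩ).integrable_of_hasCompactSupport (HasCompactSupport.intro hΨc hsuppL)
  have hiR : Integrable (fun y => ⟪-(α • (cross (EuclideanSpace.single 2 1) (Ψ y) - fderiv ℝ Ψ y (cross (EuclideanSpace.single 2 1) y))) - (1/2:ℝ) • Ψ y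
      - (1/2:ℝ) • fderiv ℝ Ψ y y - (Δ Ψ) y - fderiv ℝ Ψ y (U y) - ContinuousLinearMap.adjoint (fderiv ℝ U y) (Ψ y), Ω y⟫_ℝ) :=
    (hcΨ.inner hΩ.continuous).integrable_of_hasCompactSupport (HasCompactSupport.intro hΨc hsuppR)
  -- integrate the pointwise identity
  have hpt : ∀ y, ⟪Ψ y, α • (cross (EuclideanSpace.single 2 1) (Ω y) - fderiv ℝ Ω y (cross (EuclideanSpace.single 2 1) y)) + Ω y + (1/2:ℝ) • fderiv ℝ Ω y y
        - (Δ Ω) y + fderiv ℝ Ω y (U y) - fderiv ℝ U y (Ω y)⟫_ℝ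
      - ⟪-(α • (cross (EuclideanSpace.single 2 1) (Ψ y) - fderiv ℝ Ψ y (cross (EuclideanSpace.single 2 1) y))) - (1/2:ℝ) • Ψ y - (1/2:ℝ) • fderiv ℝ Ψ y y
        - (Δ Ψ) y - fderiv ℝ Ψ y (U y) - ContinuousLinearMap.adjoint (fderiv ℝ U y) (Ψ y), Ω y⟫_ℝ = VectorCalculus.divergence J y :=
    fun y => by rw [hJ]; exact vorticity_lagrange_identity α hU hΩ hΨ hdiv y
  have hzero : ∫ y, VectorCalculus.divergence J y = 0 := integral_divergence_eq_zero hJ1 hJc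
  have hsub := integral_sub hiL hiR
  simp only [hpt, hzero] at hsub
  linarith

end Summit.NavierStokesRegularity.NavierStokesRegularity.Theorems.DefectColumnGate

end
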